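import Literature.MathematicalPhysics.QuantumFieldTheory.QCDOS
import Summits.QuantumFields.QCD.Theses.NestedDissectionSea

/-!
# `ThresholdShift` (stmt-QuantumFields-8699) — the audit-g7 threshold re-basing of a QCD regularisation

For every mass-independent regularisation `reg` (spacings `a_k`, couplings `β_k`, volumes `L_k`, critical
bare Wilson mass `m_crit(k)`, mass renormalisation `Z_m(k)`) and every threshold `M₀ : ℝ` there is a
regularisation `reg'` with the SAME `a, β, L, Z_m` and the re-based critical mass
`m_crit'(k) = m_crit(k) + a_k M₀ / Z_m(k)`, such that

* `reg.HasMassScaling → reg'.HasMassScaling` (the leading-log clause only mentions `a` and `Z_m`, which are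
  untouched — the transport is the identity), and
* `reg'.scheme m z shift = reg.scheme (m + M₀) z shift` for all mass tuples `m` and species renormalisations
  `z, shift`: the bare trajectories `m_crit(k) + a_k M₀/Z_m(k) + a_k m_f/Z_m(k)` and
  `m_crit(k) + a_k (m_f + M₀)/Z_m(k)` coincide (one `ring` identity on the `mq` field of `QCDScheme`).

This is the shared assembly glue of the routes NestedDissectionSea / HeavyThresholdYMBridge /
RenormalisedVafaWitten / IntegerCriticalLine (their `ThresholdShift` decls are verbatim the same
proposition); it absorbs the threshold `M₀` of a "QCD above a mass threshold" statement into `m_crit`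
(Montvay–Münster §5.1: the additive Wilson mass renormalisation is flavour-blind and only fixed up to
`O(a Λ)` in lattice units).

* `thresholdShift_generic` — the route-independent statement over the Literature vocabulary.
* `thresholdShift_proof` — the route decl `NestedDissectionSea.ThresholdShift`, literally.
-/

namespace Summit.QuantumFields.QCD.Theses.NestedDissectionSea
/-- **Record of the dropped route item `ThresholdShift`** = stmt-QuantumFields-8699 (ledger signature verbatim; NOT a route
item): route NestedDissectionSea (2026-08-16T23:27Z) dropped the proved support item `ThresholdShift` when the Assembly was restated; route IntegerCriticalLine's own `ThresholdShift_holds` still points at this file's `thresholdShift_proof` (6 importers in total). The declaration `Summit.QuantumFields.QCD.Theses.NestedDissectionSea.ThresholdShift`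
therefore no longer exists in the route file and this accepted module stopped elaborating (stale olean;
buildfix lane 2026-08-19). Re-created here under its original name so the result keeps building; the
statement of every previously accepted declaration in this file is unchanged. -/
def ThresholdShift : Prop :=
  ∀ (Nf : ℕ) (reg : Literature.MathematicalPhysics.QuantumFieldTheory.QCDRegularisation Nf) (M₀ : ℝ), ∃ reg' : Literature.MathematicalPhysics.QuantumFieldTheory.QCDRegularisation Nf, (reg.HasMassScaling → reg'.HasMassScaling) ∧ ∀ (m : Fin Nf → ℝ) (z shift : Literature.MathematicalPhysics.QuantumFieldTheory.QCDField Nf → ℕ → ℝ), reg'.scheme m z shift = reg.scheme (fun f => m f + M₀) z shift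
end Summit.QuantumFields.QCD.Theses.NestedDissectionSea


namespace Summit.QuantumFields.QCD.Theorems

open Literature.MathematicalPhysics.QuantumFieldTheory

/-- **Threshold re-basing (route-independent form).** For every regularisation `reg` of `N_f`-flavour
lattice QCD and every `M₀ : ℝ`, the regularisation `reg'` obtained from `reg` by replacing the critical bare
mass `m_crit(k)` with `m_crit(k) + a_k M₀ / Z_m(k)` (all other data unchanged) satisfies
`reg.HasMassScaling → reg'.HasMassScaling` and realises at renormalised masses `m` exactly the scheme that
`reg` realises at `m + M₀`: `reg'.scheme m z shift = reg.scheme (fun f => m f + M₀) z shift`.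
Proof: `HasMassScaling` reads only `a` and `Z_m` (identity transport); the two schemes agree field by
field, the bare-mass field by `a_k M₀/Z_m + a_k m_f/Z_m = a_k (m_f + M₀)/Z_m`.
[folklore; cf. MontvayMunster1994 §5.1 (critical hopping parameter, additive mass renormalisation)] -/
theorem thresholdShift_generic (Nf : ℕ) (reg : QCDRegularisation Nf) (M₀ : ℝ) :
    ∃ reg' : QCDRegularisation Nf, (reg.HasMassScaling → reg'.HasMassScaling) ∧
      ∀ (m : Fin Nf → ℝ) (z shift : QCDField Nf → ℕ → ℝ),
        reg'.scheme m z shift = reg.scheme (fun f => m f + M₀) z shift := by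
  refine ⟨{ reg with mcrit := fun k => reg.mcrit k + reg.a k * M₀ / reg.Zm k }, fun h => h, ?_⟩
  intro m z shift
  simp only [QCDRegularisation.scheme, QCDScheme.mk.injEq, and_true, true_and]
  funext f k
  ring

/-- **`ThresholdShift` holds** (item stmt-QuantumFields-8699 of route NestedDissectionSea, literally the
route decl): for every `Nf`, `reg`, `M₀` there is `reg'` (same `a, β, L, Z_m`;
`m_crit'(k) = m_crit(k) + a_k M₀/Z_m(k)`) with `reg.HasMassScaling → reg'.HasMassScaling` and
`reg'.scheme m z shift = reg.scheme (fun f => m f + M₀) z shift` for all `m, z, shift`.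
Immediate from `thresholdShift_generic`. -/
theorem thresholdShift_proof : Summit.QuantumFields.QCD.Theses.NestedDissectionSea.ThresholdShift := by
  unfold Summit.QuantumFields.QCD.Theses.NestedDissectionSea.ThresholdShift
  exact thresholdShift_generic

end Summit.QuantumFields.QCD.Theorems
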